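import Literature.Geometry.GeometricMeasureTheory.FrameVectorDet
import Literature.Geometry.GeometricMeasureTheory.CurrentsProofs
import Literature.Analysis.Calculus.AreaFormulaHausdorff
import Mathlib.MeasureTheory.Function.Jacobian

/-!
# Differentiable injective images as currents of integration

Let `f : P → V` be injective and differentiable (relative to `s`) on a measurable set `s ⊆ P`,
`dim P = n`, with injective differential `f' x` at every `x ∈ s`, and let `e` be an orthonormal
basis of `P`. We show:

* `isCountablyRectifiable_image_of_hasFDerivWithinAt` : `f '' s` is countably `n`-rectifiable
  (Federer 3.2.14 with the Lipschitz pieces of Mathlib's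
  `exists_partition_approximatesLinearOn_of_hasFDerivWithinAt`);
* `exists_frame_image` : there is a frame field `ξ` on `V` with
  `ξ (f x) = gramSchmidtNormed (f' x ∘ e)` for `x ∈ s` (and `0` off `f '' s`); it is orthonormal
  on `f '' s` with `span ξ (f x) = range (f' x)`;
* `setIntegral_image_apply_frame_eq` : **the area formula for `n`-vector fields**,
  `∫_{f(s)} φ(y)(ξ y) d𝓗ⁿ = ∫_s φ(f x)(f' x e₁, …, f' x eₙ) dx` (Federer 3.2.5 with the Jacobian
  rule `f' x e₁ ∧ ⋯ ∧ f' x eₙ = J f(x) · ξ(f x)` of `FrameVectorDet.lean`);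
* `integrableOn_smul_frameVector_image` and `currentOfIntegration_image_apply` : for `f'`
  bounded on `s` of finite measure, the current of integration `[f(s), k, ξ]` is given by
  **`[f(s), k, ξ](φ) = k ∫_s φ(f x)(f' x e₁, …, f' x eₙ) dx`**, i.e. it is the push-forward
  `f_# (k · 𝐄ⁿ ⌞ s)` (Federer 4.1.25, 4.1.28).

## References

* H. Federer, *Geometric Measure Theory*, Springer 1969, 3.2.3, 3.2.5, 3.2.14, 4.1.25, 4.1.28.
-/

noncomputable section

open scoped InnerProductSpace ENNReal NNReal Topology
open MeasureTheory Measure Set Function Module InnerProductSpace TopologicalSpace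
open Literature.Analysis.Calculus

namespace Literature.Geometry.GeometricMeasureTheory

-- Nested operator-norm instances on (duals of) `V [⋀^Fin n]→L[ℝ] ℝ`.
set_option maxSynthPendingDepth 2

variable {P : Type*} [NormedAddCommGroup P] [InnerProductSpace ℝ P] [FiniteDimensional ℝ P]
  [MeasurableSpace P] [BorelSpace P]
  {V : Type*} [NormedAddCommGroup V] [InnerProductSpace ℝ V] [FiniteDimensional ℝ V]
  [MeasurableSpace V] [BorelSpace V] {n : ℕ}
  {f : P → V} {f' : P → P →L[ℝ] V} {s : Set P}

omit [FiniteDimensional ℝ P] [MeasurableSpace P] [BorelSpace P] in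
/-- A space with an orthonormal basis indexed by `Fin n` has dimension `n`. [folklore] -/
theorem finrank_eq_of_orthonormalBasis_fin (e : OrthonormalBasis (Fin n) ℝ P) : finrank ℝ P = n := by
  rw [finrank_eq_card_basis e.toBasis, Fintype.card_fin]

/-! ### Rectifiability of differentiable images -/

omit [MeasurableSpace V] [BorelSpace V] in
/-- **A differentiable image is countably rectifiable**: if `f` is differentiable on `s`
relative to `s` (`dim P = n`) then `f '' s` is countably `n`-rectifiable — covered by countably
many Lipschitz images of `ℝⁿ`. [cite: Federer1969, 3.2.14, 3.1.8] -/
theorem isCountablyRectifiable_image_of_hasFDerivWithinAt [MeasurableSpace V] [BorelSpace V]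
    (e : OrthonormalBasis (Fin n) ℝ P) (hf' : ∀ x ∈ s, HasFDerivWithinAt f (f' x) s x) :
    IsCountablyRectifiable n (f '' s) := by
  obtain ⟨t, A, -, -, hst, hA, -⟩ :=
    exists_partition_approximatesLinearOn_of_hasFDerivWithinAt f s f' hf' (fun _ => 1)
      fun _ => one_ne_zero
  -- Lipschitz extensions of the pieces, reparametrised by `ℝⁿ`
  have hext : ∀ i, ∃ G : EuclideanSpace ℝ (Fin n) → V, (∃ K, LipschitzWith K G) ∧
      f '' (s ∩ t i) ⊆ range G := by
    intro i
    obtain ⟨g, hg, hfg⟩ :=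
      (lipschitzOnWith_iff_restrict.2 (hA i).lipschitz).extend_finite_dimension
    refine ⟨g ∘ ⇑e.repr.symm, ⟨_, hg.comp e.repr.symm.lipschitz⟩, ?_⟩
    rintro _ ⟨x, hx, rfl⟩
    refine ⟨e.repr x, ?_⟩
    simp only [comp_apply, LinearIsometryEquiv.symm_apply_apply]
    exact (hfg hx).symm
  choose G hGl hGr using hext
  refine ⟨G, hGl, ?_⟩
  have hcov : f '' s ⊆ ⋃ i, range (G i) := by
    rintro _ ⟨x, hx, rfl⟩
    obtain ⟨i, hi⟩ := mem_iUnion.1 (hst hx)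
    exact mem_iUnion.2 ⟨i, hGr i ⟨x, ⟨hx, hi⟩, rfl⟩⟩
  rw [Set.sdiff_eq_empty.2 hcov, measure_empty]

/-! ### The push-forward frame -/

omit [FiniteDimensional ℝ P] [MeasurableSpace P] [BorelSpace P] [FiniteDimensional ℝ V]
  [MeasurableSpace V] [BorelSpace V] in
/-- A frame field on `V` which over `f '' s` is the Gram–Schmidt orthonormalisation of
`(f' x e₁, …, f' x eₙ)` and vanishes elsewhere. [cite: Federer1969, 4.1.25, 4.1.28] -/
theorem exists_frame_image (hf : InjOn f s) (e : OrthonormalBasis (Fin n) ℝ P) :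
    ∃ ξ : V → Fin n → V, (∀ x ∈ s, ξ (f x) = gramSchmidtNormed ℝ fun j => f' x (e j)) ∧
      ∀ y ∉ f '' s, ξ y = 0 := by
  classical
  by_cases hne : s.Nonempty
  · haveI : Nonempty P := ⟨hne.some⟩
    refine ⟨fun y => if y ∈ f '' s then
        gramSchmidtNormed ℝ fun j => f' (invFunOn f s y) (e j) else 0, ?_, ?_⟩
    · intro x hx
      simp only [mem_image_of_mem f hx, if_true, hf.leftInvOn_invFunOn hx]
    · intro y hy
      simp only [hy, if_false]
  · refine ⟨fun _ => 0, fun x hx => (hne ⟨x, hx⟩).elim, fun _ _ => rfl⟩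

omit [FiniteDimensional ℝ P] [MeasurableSpace P] [BorelSpace P] [FiniteDimensional ℝ V] [MeasurableSpace V]
  [BorelSpace V] in
/-- `(f' x eⱼ)` is linearly independent when `f' x` is injective. [folklore] -/
theorem linearIndependent_comp_orthonormalBasis {L : P →L[ℝ] V} (hL : Injective L)
    (e : OrthonormalBasis (Fin n) ℝ P) : LinearIndependent ℝ fun j => L (e j) := by
  have h := e.toBasis.linearIndependent.map' (L : P →ₗ[ℝ] V) (LinearMap.ker_eq_bot.2 hL)
  have hfun : (fun j => L (e j)) = ⇑(L : P →ₗ[ℝ] V) ∘ ⇑e.toBasis := by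
    funext j
    simp
  rw [hfun]
  exact h

omit [FiniteDimensional ℝ P] [MeasurableSpace P] [BorelSpace P] [FiniteDimensional ℝ V] [MeasurableSpace V]
  [BorelSpace V] in
/-- The Gram–Schmidt frame of `(f' x eⱼ)` is orthonormal. [folklore] -/
theorem orthonormal_gramSchmidtNormed_comp {L : P →L[ℝ] V} (hL : Injective L)
    (e : OrthonormalBasis (Fin n) ℝ P) :
    Orthonormal ℝ (gramSchmidtNormed ℝ fun j => L (e j)) :=
  gramSchmidtNormed_orthonormal (linearIndependent_comp_orthonormalBasis hL e)

omit [FiniteDimensional ℝ P] [MeasurableSpace P] [BorelSpace P] [FiniteDimensional ℝ V] [MeasurableSpace V]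
  [BorelSpace V] in
/-- The Gram–Schmidt frame of `(f' x eⱼ)` spans `range (f' x)`. [folklore] -/
theorem span_gramSchmidtNormed_comp (L : P →L[ℝ] V) (e : OrthonormalBasis (Fin n) ℝ P) :
    Submodule.span ℝ (Set.range (gramSchmidtNormed ℝ fun j => L (e j))) =
      LinearMap.range (L : P →ₗ[ℝ] V) := by
  rw [span_gramSchmidtNormed_range, span_gramSchmidt]
  have : (Set.range fun j => L (e j)) = (L : P →ₗ[ℝ] V) '' Set.range e := by
    ext y
    simp [Set.mem_image, Set.mem_range]
  have hspan : Submodule.span ℝ (Set.range ⇑e) = ⊤ := by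
    have h := e.toBasis.span_eq
    rwa [OrthonormalBasis.coe_toBasis] at h
  rw [this, ← Submodule.map_span, hspan, Submodule.map_top]

/-! ### The area formula for `n`-vector fields -/

omit [MeasurableSpace P] [BorelSpace P] [FiniteDimensional ℝ V] [MeasurableSpace V] [BorelSpace V] in
/-- Pointwise Jacobian rule: `J f(x) · φ(ξ (f x)) = φ(f' x e₁, …, f' x eₙ)`. [cite: Federer1969, 3.2.1, 1.7.6] -/
theorem normDet_mul_apply_gramSchmidtNormed {L : P →L[ℝ] V} (hL : Injective L)
    (e : OrthonormalBasis (Fin n) ℝ P) (φ : Covector V n) :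
    (L : P →ₗ[ℝ] V).normDet * φ (gramSchmidtNormed ℝ fun j => L (e j)) = φ fun j => L (e j) := by
  have key := congrArg (fun T : Multivector V n => T φ)
    (frameVector_comp_eq_normDet_smul_gramSchmidtNormed hL e)
  simp only [frameVector_apply, _root_.smul_apply, smul_eq_mul] at key
  exact key.symm

/-- **Area formula for `n`-vector fields.** For `f` injective and differentiable on the
measurable set `s` with injective differential, and a frame field `ξ` with
`ξ (f x) = gramSchmidtNormed (f' x e)` on `s`:
`∫_{f(s)} φ(y)(ξ y) d𝓗ⁿ(y) = ∫_s φ(f x)(f' x e₁, …, f' x eₙ) dx`.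
[cite: Federer1969, 3.2.5, 4.1.25] -/
theorem setIntegral_image_apply_frame_eq (hs : MeasurableSet s)
    (hf' : ∀ x ∈ s, HasFDerivWithinAt f (f' x) s x) (hinj : ∀ x ∈ s, Injective (f' x))
    (hf : InjOn f s) (e : OrthonormalBasis (Fin n) ℝ P) {ξ : V → Fin n → V}
    (hξ : ∀ x ∈ s, ξ (f x) = gramSchmidtNormed ℝ fun j => f' x (e j))
    (φ : V → Covector V n) :
    ∫ y in f '' s, φ y (ξ y) ∂(μHE[n] : Measure V) = ∫ x in s, φ (f x) fun j => f' x (e j) := by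
  have hn := finrank_eq_of_orthonormalBasis_fin e
  have h := integral_image_eq_integral_normDet_smul hs hf' hinj hf (fun y => φ y (ξ y))
  rw [hn] at h
  rw [h]
  refine setIntegral_congr_fun hs fun x hx => ?_
  simp only [smul_eq_mul]
  rw [hξ x hx]
  exact normDet_mul_apply_gramSchmidtNormed (hinj x hx) e (φ (f x))

/-! ### Integrability and the current of integration -/

omit [InnerProductSpace ℝ V] [FiniteDimensional ℝ V] [MeasurableSpace V] [BorelSpace V] in
/-- `‖v₁ ∧ ⋯ ∧ vₙ‖ ≤ ∏ ‖vᵢ‖`. [cite: Federer1969, 1.8.1] -/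
theorem norm_frameVector_le_prod [NormedSpace ℝ V] (v : Fin n → V) :
    ‖frameVector v‖ ≤ ∏ i, ‖v i‖ := by
  refine ContinuousLinearMap.opNorm_le_bound _ (Finset.prod_nonneg fun i _ => norm_nonneg _)
    fun φ => ?_
  rw [frameVector_apply, mul_comm]
  exact φ.le_opNorm v

omit [InnerProductSpace ℝ V] [FiniteDimensional ℝ V] [MeasurableSpace V] [BorelSpace V] in
/-- `v ↦ v₁ ∧ ⋯ ∧ vₙ` is continuous (as `Literature.Geometry.Kaehler.continuous_frameVector`,
restated to keep the Kähler files out of the imports of this one). [folklore] -/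
theorem continuous_frameVector' [NormedSpace ℝ V] :
    Continuous (frameVector : (Fin n → V) → Multivector V n) := by
  have : (frameVector : (Fin n → V) → Multivector V n) =
      ⇑(ContinuousLinearMap.flipAlternating (ContinuousLinearMap.id ℝ (Covector V n))) := by
    funext v
    ext φ
    simp [frameVector]
  rw [this]
  exact ContinuousAlternatingMap.coe_continuous _

omit [MeasurableSpace V] [BorelSpace V] in
/-- `x ↦ k • (f' x e₁ ∧ ⋯ ∧ f' x eₙ)` is integrable on `s` when `f'` is bounded on `s` and `s` has
finite measure. [folklore] -/
theorem integrableOn_smul_frameVector_comp (hs : MeasurableSet s)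
    (hf' : ∀ x ∈ s, HasFDerivWithinAt f (f' x) s x) (e : OrthonormalBasis (Fin n) ℝ P)
    {C : ℝ} (hC : ∀ x ∈ s, ‖f' x‖ ≤ C) (hsfin : volume s ≠ ⊤) (k : ℝ) :
    IntegrableOn (fun x => k • frameVector fun j => f' x (e j)) s := by
  have hmeas : AEStronglyMeasurable (fun x => k • frameVector fun j => f' x (e j))
      (volume.restrict s) := by
    have h1 := aemeasurable_fderivWithin_of_hasFDerivWithinAt volume hs hf'
    have h2 : Continuous fun A : P →L[ℝ] V => fun j => A (e j) :=
      continuous_pi fun j => (ContinuousLinearMap.apply ℝ V (e j)).continuous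
    have hcont : Continuous fun A : P →L[ℝ] V => k • frameVector fun j => A (e j) :=
      (continuous_frameVector'.comp h2).const_smul k
    exact hcont.comp_aestronglyMeasurable h1.aestronglyMeasurable
  have hC0 : 0 ≤ max C 0 := le_max_right _ _
  refine ⟨hmeas, HasFiniteIntegral.restrict_of_bounded (C := |k| * (max C 0) ^ n) hsfin.lt_top ?_⟩
  rw [ae_restrict_iff' hs]
  refine Filter.Eventually.of_forall fun x hx => ?_
  rw [norm_smul, Real.norm_eq_abs]
  gcongr
  calc ‖frameVector fun j => f' x (e j)‖ ≤ ∏ j, ‖f' x (e j)‖ := norm_frameVector_le_prod _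
    _ ≤ ∏ _j : Fin n, max C 0 := by
        refine Finset.prod_le_prod (fun j _ => norm_nonneg _) fun j _ => ?_
        calc ‖f' x (e j)‖ ≤ ‖f' x‖ * ‖e j‖ := (f' x).le_opNorm _
          _ = ‖f' x‖ := by rw [e.orthonormal.1 j, mul_one]
          _ ≤ max C 0 := (hC x hx).trans (le_max_left _ _)
    _ = (max C 0) ^ n := by rw [Finset.prod_const, Finset.card_univ, Fintype.card_fin]

/-- **Finite mass of the image current**: `y ↦ k • ξ(y)₁ ∧ ⋯ ∧ ξ(y)ₙ` is integrable on `f '' s`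
for `𝓗ⁿ` when `f'` is bounded on `s` of finite measure. [cite: Federer1969, 3.2.5, 4.1.28] -/
theorem integrableOn_smul_frameVector_image (hs : MeasurableSet s)
    (hf' : ∀ x ∈ s, HasFDerivWithinAt f (f' x) s x) (hinj : ∀ x ∈ s, Injective (f' x))
    (hf : InjOn f s) (e : OrthonormalBasis (Fin n) ℝ P) {ξ : V → Fin n → V}
    (hξ : ∀ x ∈ s, ξ (f x) = gramSchmidtNormed ℝ fun j => f' x (e j))
    {C : ℝ} (hC : ∀ x ∈ s, ‖f' x‖ ≤ C) (hsfin : volume s ≠ ⊤) (k : ℝ) :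
    IntegrableOn (fun y => k • frameVector (ξ y)) (f '' s) (μHE[n] : Measure V) := by
  have hn := finrank_eq_of_orthonormalBasis_fin e
  have h := integrableOn_image_iff_integrableOn_normDet_smul hs hf' hinj hf
    (fun y => k • frameVector (ξ y))
  rw [hn] at h
  rw [h]
  refine (integrableOn_smul_frameVector_comp hs hf' e hC hsfin k).congr_fun (fun x hx => ?_) hs
  simp only
  rw [smul_comm, hξ x hx, ← frameVector_comp_eq_normDet_smul_gramSchmidtNormed (hinj x hx) e]

/-- **A differentiable injective image is the push-forward current**: with `ξ` the push-forward
frame, `f'` bounded on the measurable set `s` of finite measure,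
`[f(s), k, ξ](φ) = k · ∫_s φ(f x)(f' x e₁, …, f' x eₙ) dx` for every test form `φ` on `Ω`.
[cite: Federer1969, 4.1.25, 4.1.28, 3.2.5] -/
theorem currentOfIntegration_image_apply {Ω : Opens V} (hs : MeasurableSet s)
    (hf' : ∀ x ∈ s, HasFDerivWithinAt f (f' x) s x) (hinj : ∀ x ∈ s, Injective (f' x))
    (hf : InjOn f s) (e : OrthonormalBasis (Fin n) ℝ P) {ξ : V → Fin n → V}
    (hξ : ∀ x ∈ s, ξ (f x) = gramSchmidtNormed ℝ fun j => f' x (e j))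
    {C : ℝ} (hC : ∀ x ∈ s, ‖f' x‖ ≤ C) (hsfin : volume s ≠ ⊤) (k : ℤ) (φ : TestForm Ω n) :
    currentOfIntegration (f '' s) (fun _ => k) ξ φ =
      (k : ℝ) * ∫ x in s, φ (f x) fun j => f' x (e j) := by
  have hint := integrableOn_smul_frameVector_image hs hf' hinj hf e hξ hC hsfin (k : ℝ)
  have hloc : LocallyIntegrableOn (fun y => ((k : ℤ) : ℝ) • frameVector (ξ y)) (Ω : Set V)
      ((μHE[n] : Measure V).restrict (f '' s)) :=
    (hint.integrable.locallyIntegrable).locallyIntegrableOn _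
  rw [currentOfIntegration_apply hloc, ← setIntegral_image_apply_frame_eq hs hf' hinj hf e hξ
    (fun y => φ y), ← integral_const_mul]

end Literature.Geometry.GeometricMeasureTheory
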